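import Summits.HodgeConjecture.HodgeConjecture.Theorems.Ring2WeilCoverageCyclotomicUnitSignaturesFamily
import Summits.HodgeConjecture.HodgeConjecture.Theorems.Ring2WeilCoverageCyclotomicUnitGeomSums
import HarnessLib

/-!
# Weil-type family coverage — THEOREM L (ii)-type statement IS KERNEL at the prime-power level `32` (`g = 8`): every
# even sign pattern on a CM type of `ℚ(ζ₃₂)` is a real unit's (geometric-sum units), and the census's YES rows
# `(32, ℚ(i))`, `(32, ℚ(√−2))` are UNCONDITIONAL

research route conditional on HC_CM; not a corollary; Q11.4-sentence-2 already refuted in dim ≥ 3.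

Ring 2, WEIL-TYPE FAMILY-COVERAGE CENSUS (`HOME/WEIL-FAMILY-COVERAGE.md` `## b01`, block b01.23 (A)/(D) «YES for ALL
THIRTY g = 8 classes (ℚ(ζ₃₂), ℚ(ζ₄₀), ℚ(ζ₄₈), ℚ(ζ₆₀); every K)», owner ring2-b01), part 22 of the `Ring2WeilCoverage*`
series.  At `M = 32 = 2⁵` no `1 − ζ^a` is a unit, so parts 13/15–19 do not apply; the geometric-sum units
`v(a, c) = ζ^c(1 + ζ + ⋯ + ζ^{a−1})` of part 20 (`a` odd, `2c + a − 1 ≡ 0 (mod 64)`; sign law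
`negAtG (a,c) t := 32 < at mod 64`, value `sin(πat/32)/sin(πt/32)`) have FULL sign rank `8` at the eight real places
(so `ℚ(ζ₃₂)⁺` even has units of every signature; only the even patterns are needed here):

* `familyProperty_thirtyTwo`: part 21's family property for (`negAtG`, admissibility) from part 20;
  `witnessTable_thirtyTwo` (`decide +kernel`; generators `(a,c)` = (3,31), (5,30), (7,29), (9,28), (11,27), (13,26), (15,25)) and
  `witnessProperty_thirtyTwo`: the witness property `(W)`.
* **`exists_units_sign_eq_thirtyTwo`** — every even sign pattern on a CM type of `ℚ(ζ₃₂)` is a real unit's; and the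
  two census rows **`exists_principal_thirtyTwo_sqrt_neg_one`**, **`exists_principal_thirtyTwo_sqrt_neg_two`**:
  for every CM type `Φ` balanced for the displayed `N_K` (`n₋ = 4` both), the principal CM torus `ℂ^Φ/Φ(ℤ[ζ₃₂])`
  CARRIES an `ι`-compatible principal polarisation.  With parts 15–19 the census's YES verdicts are kernel theorems
  at EVERY `h = 1` cyclotomic level of Weil type: `21, 28, 32, 33, 36, 40, 44, 48, 60, 84`.

HONEST FRAMING: statements about Shimura's divisors `X_ζ′` of PRINCIPAL type on the principal CM torus and about
units of `𝓞 K`; the sets `N_K` are displayed finite sets of residues (`χ_{−4}(t) = −1 ⟺ t ≡ 3 (4)`,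
`χ_{−8}(t) = −1 ⟺ t ≡ 5, 7 (8)` — docstring-level); nothing about Hodge classes, `W_K`, general members or HC; `HC_CM`
is used nowhere.  No `def`, no named fact, no `sorry`.

References: [cite: Shimura1998, §14.3 Prop. 4–5, pp. 103–104]; [cite: Washington1997, §8.1, Lemma 8.1]; census
b01.23 (A)/(D) (seat-derived).
-/

noncomputable section

open Polynomial NumberField Complex Finset
open scoped Real nonZeroDivisors

namespace Summit.HodgeConjecture.Ring2WeilCoverage.CyclotomicSignaturesLevel32

open Literature.AlgebraicGeometry.Motives (CMType)
open Literature.AlgebraicGeometry.HodgeTheory (IsCMTypeSet)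
open Literature.NumberTheory.ComplexMultiplication
open Literature.AlgebraicGeometry.ComplexMultiplication.CyclotomicCMType (exists_apply_eq_toCircle)
open Summit.HodgeConjecture.Ring2WeilCoverage.CyclotomicUnitSignaturesFamily
open Summit.HodgeConjecture.Ring2WeilCoverage.CyclotomicUnitGeomSums

variable {K : Type} [Field K] [NumberField K] {ζ : K}

/-- `𝐞(t) = exp(2πi t/32) ∈ ℂ` (`ZMod.toCircle`). -/
local notation3 (prettyPrint := false) "𝐞 " t:max => ((ZMod.toCircle t : Circle) : ℂ)

/-- the sign law of the geometric-sum unit `v(a,c)` at the unit residue `t` (part 20): `32 < at mod 64`. -/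
local notation3 (prettyPrint := false) "negAtG" =>
  (fun (x : ℕ × ℕ) (t : ZMod 32) => 32 < x.1 * ZMod.val t % (2 * 32))

/-- admissibility of a pair `(a, c)` (part 20): `a` prime to `32`, `(2c + a − 1) mod 64 = 0`, `a ≥ 1`. -/
local notation3 (prettyPrint := false) "admG" =>
  (fun x : ℕ × ℕ => Nat.Coprime x.1 32 ∧ (2 * x.2 + x.1 - 1) % (2 * 32) = 0 ∧ 1 ≤ x.1)

/-- the sign pattern of the signed product `(A, ε)` at `t`. -/
local notation3 (prettyPrint := false) "pat " A:max ε:max t:max =>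
  Odd ((Finset.filter (fun x : ℕ × ℕ => negAtG x t) A).card + (if (ε : Bool) then 1 else 0))

/-- **The family property of part 21 for the geometric-sum units at level 32**: admissible signed products are units
of `𝓞 K` fixed by `ρ` with the sign law `negAtG` (part 20).
research route conditional on HC_CM; not a corollary; Q11.4-sentence-2 already refuted in dim ≥ 3. [cite: Washington1997, §8.1, Lemma 8.1] -/
theorem familyProperty_thirtyTwo [IsCMField K] (hζ : IsPrimitiveRoot ζ 32) :
    ∀ A : Finset (ℕ × ℕ), (∀ x ∈ A, admG x) → ∀ ε : Bool,
      ∃ u : (𝓞 K)ˣ, IsCMField.complexConj K ((u : 𝓞 K) : K) = ((u : 𝓞 K) : K) ∧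
        ∀ (φ : K →+* ℂ) (t : ZMod 32), φ ζ = 𝐞 t → t.val.Coprime 32 →
          (((φ ((u : 𝓞 K) : K)).re < 0) ↔ pat A ε t) := by
  intro A hA ε
  obtain ⟨u, hu, hconj⟩ := exists_units_coe_eq_geomSum (by norm_num) hζ hA ε
  refine ⟨u, hconj, fun φ t hφt ht => ?_⟩
  rw [hu]
  exact (re_embedding_prod_geomSum_neg_iff (by norm_num) hφt ht A hA ε).1

/-- **Witness table at level 32** (`decide +kernel`): for every unit residue `s ∉ {1, −1}` mod `32` the listed signed
product of admissible geometric-sum units is negative exactly at the places `{±1, ±s}`.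
research route conditional on HC_CM; not a corollary; Q11.4-sentence-2 already refuted in dim ≥ 3. [folklore] -/
theorem witnessTable_thirtyTwo :
    ∀ s ∈ (Finset.univ.filter fun s : ZMod 32 => s.val.Coprime 32 ∧ s ≠ 1 ∧ s ≠ -1),
      ∃ w ∈ ({
    (3, {(3, 31), (11, 27), (15, 25)}, true),
    (5, {(3, 31), (5, 30), (9, 28), (11, 27), (13, 26), (15, 25)}, true),
    (7, {(5, 30), (7, 29), (13, 26)}, true),
    (9, {(3, 31), (5, 30), (7, 29), (15, 25)}, true),
    (11, {(3, 31), (9, 28), (13, 26)}, true),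
    (13, {(7, 29), (9, 28), (11, 27), (13, 26), (15, 25)}, true),
    (15, {(5, 30), (7, 29), (9, 28), (11, 27)}, true),
    (17, {(5, 30), (7, 29), (9, 28), (11, 27)}, true),
    (19, {(7, 29), (9, 28), (11, 27), (13, 26), (15, 25)}, true),
    (21, {(3, 31), (9, 28), (13, 26)}, true),
    (23, {(3, 31), (5, 30), (7, 29), (15, 25)}, true),
    (25, {(5, 30), (7, 29), (13, 26)}, true),
    (27, {(3, 31), (5, 30), (9, 28), (11, 27), (13, 26), (15, 25)}, true),
    (29, {(3, 31), (11, 27), (15, 25)}, true)} :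
      Finset (ZMod 32 × Finset (ℕ × ℕ) × Bool)),
        w.1 = s ∧ (∀ x ∈ w.2.1, admG x) ∧
          ∀ t ∈ (Finset.univ.filter fun t : ZMod 32 => t.val.Coprime 32),
            (pat w.2.1 w.2.2 t ↔ (t = 1 ∨ t = -1 ∨ t = s ∨ t = -s)) := by
  decide +kernel

/-- **The witness property `(W)` of part 21 holds at level 32** for the geometric-sum family.
research route conditional on HC_CM; not a corollary; Q11.4-sentence-2 already refuted in dim ≥ 3. [folklore] -/
theorem witnessProperty_thirtyTwo :
    ∀ s : ZMod 32, s.val.Coprime 32 → s ≠ 1 → s ≠ -1 →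
      ∃ A : Finset (ℕ × ℕ), ∃ ε : Bool, (∀ x ∈ A, admG x) ∧
        ∀ t : ZMod 32, t.val.Coprime 32 → (pat A ε t ↔ (t = 1 ∨ t = -1 ∨ t = s ∨ t = -s)) := by
  intro s hs h1 h2
  obtain ⟨w, -, rfl, hA, hP⟩ :=
    witnessTable_thirtyTwo s (Finset.mem_filter.mpr ⟨Finset.mem_univ _, hs, h1, h2⟩)
  exact ⟨w.2.1, w.2.2, hA, fun t ht => hP t (Finset.mem_filter.mpr ⟨Finset.mem_univ _, ht⟩)⟩

open scoped Classical in
/-- **Every even sign pattern on a CM type of `ℚ(ζ₃₂)` is a real unit's** (by explicit geometric-sum cyclotomic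
units; no class number, no CFT): for any `K` with `IsCyclotomicExtension {32} ℚ K`, `[IsCMField K]`, every CM type
`Φ` and every `S ⊆ Φ` of even size there is a unit of `𝓞 K` fixed by `ρ`, negative exactly on `S`.
research route conditional on HC_CM; not a corollary; Q11.4-sentence-2 already refuted in dim ≥ 3. [cite: Washington1997, §8.1, Lemma 8.1] -/
theorem exists_units_sign_eq_thirtyTwo [IsCMField K] [IsCyclotomicExtension {32} ℚ K] (hζ : IsPrimitiveRoot ζ 32)
    (Φ : CMType K) (S : Set (K →+* ℂ)) (hS : S ⊆ Φ.1) (hev : Even S.ncard) :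
    ∃ u : (𝓞 K)ˣ, IsCMField.complexConj K ((u : 𝓞 K) : K) = ((u : 𝓞 K) : K) ∧
      ∀ φ ∈ Φ.1, ((φ ((u : 𝓞 K) : K)).re < 0 ↔ φ ∈ S) :=
  exists_units_sign_eq_family _ _ hζ (familyProperty_thirtyTwo hζ) witnessProperty_thirtyTwo Φ S hS hev

open scoped Classical in
/-- **CENSUS ROW `(ℚ(ζ₃₂), ℚ(i))` — UNCONDITIONAL YES: the principal CM torus `ℂ^Φ/Φ(ℤ[ζ₃₂])` CARRIES an
`ι`-compatible principal polarisation** for every CM type `Φ` of `ℚ(ζ₃₂)` balanced for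
`N_K = {3, 7, 11, 15, 19, 23, 27, 31}` (the unit residues `t` with `χ_K(t) = −1`, `K = ℚ(i)`; `n₋ = 4` is even):
`∃ ζ′, ζ′^ρ = −ζ′ ∧ (∀ φ ∈ Φ, Im φ(ζ′) > 0) ∧ CMTypeLattice.IsOfType 1 ζ′ ⊤` (parts 7/20/21 + the table).
research route conditional on HC_CM; not a corollary; Q11.4-sentence-2 already refuted in dim ≥ 3. [cite: Shimura1998, §14.3 Prop. 5, p. 104] -/
theorem exists_principal_thirtyTwo_sqrt_neg_one [IsCMField K] [IsCyclotomicExtension {32} ℚ K]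
    (hζ : IsPrimitiveRoot ζ 32) (Φ : CMType K)
    (hbal : 2 * ((Finset.univ.filter fun t : ZMod 32 => ∃ σ ∈ Φ.1, σ ζ = 𝐞 t) ∩
        ({3, 7, 11, 15, 19, 23, 27, 31} : Finset (ZMod 32))).card =
      (Finset.univ.filter fun t : ZMod 32 => ∃ σ ∈ Φ.1, σ ζ = 𝐞 t).card) :
    ∃ ζ' : K, IsCMField.complexConj K ζ' = -ζ' ∧ (∀ φ : Φ.1, 0 < (φ.1 ζ').im) ∧
        CMTypeLattice.IsOfType (1 : (FractionalIdeal (𝓞 K)⁰ K)ˣ) ζ' ⊤ := by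
  have hg : Nat.totient 32 = 2 * (7 + 1) := by decide
  have hNK : IsCMTypeSet 32 ({3, 7, 11, 15, 19, 23, 27, 31} : Finset (ZMod 32)) := by decide
  have heven : Even (({3, 7, 11, 15, 19, 23, 27, 31} : Finset (ZMod 32)).filter fun t : ZMod 32 => 2 * t.val < 32).card := by
    decide
  exact exists_principal_of_family _ _ hζ hg (familyProperty_thirtyTwo hζ) witnessProperty_thirtyTwo Φ hNK hbal heven

open scoped Classical in
/-- **CENSUS ROW `(ℚ(ζ₃₂), ℚ(√−2))` — UNCONDITIONAL YES: the principal CM torus `ℂ^Φ/Φ(ℤ[ζ₃₂])` CARRIES an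
`ι`-compatible principal polarisation** for every CM type `Φ` of `ℚ(ζ₃₂)` balanced for
`N_K = {5, 7, 13, 15, 21, 23, 29, 31}` (the unit residues `t` with `χ_K(t) = −1`, `K = ℚ(√−2)`; `n₋ = 4` is even):
`∃ ζ′, ζ′^ρ = −ζ′ ∧ (∀ φ ∈ Φ, Im φ(ζ′) > 0) ∧ CMTypeLattice.IsOfType 1 ζ′ ⊤` (parts 7/20/21 + the table).
research route conditional on HC_CM; not a corollary; Q11.4-sentence-2 already refuted in dim ≥ 3. [cite: Shimura1998, §14.3 Prop. 5, p. 104] -/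
theorem exists_principal_thirtyTwo_sqrt_neg_two [IsCMField K] [IsCyclotomicExtension {32} ℚ K]
    (hζ : IsPrimitiveRoot ζ 32) (Φ : CMType K)
    (hbal : 2 * ((Finset.univ.filter fun t : ZMod 32 => ∃ σ ∈ Φ.1, σ ζ = 𝐞 t) ∩
        ({5, 7, 13, 15, 21, 23, 29, 31} : Finset (ZMod 32))).card =
      (Finset.univ.filter fun t : ZMod 32 => ∃ σ ∈ Φ.1, σ ζ = 𝐞 t).card) :
    ∃ ζ' : K, IsCMField.complexConj K ζ' = -ζ' ∧ (∀ φ : Φ.1, 0 < (φ.1 ζ').im) ∧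
        CMTypeLattice.IsOfType (1 : (FractionalIdeal (𝓞 K)⁰ K)ˣ) ζ' ⊤ := by
  have hg : Nat.totient 32 = 2 * (7 + 1) := by decide
  have hNK : IsCMTypeSet 32 ({5, 7, 13, 15, 21, 23, 29, 31} : Finset (ZMod 32)) := by decide
  have heven : Even (({5, 7, 13, 15, 21, 23, 29, 31} : Finset (ZMod 32)).filter fun t : ZMod 32 => 2 * t.val < 32).card := by
    decide
  exact exists_principal_of_family _ _ hζ hg (familyProperty_thirtyTwo hζ) witnessProperty_thirtyTwo Φ hNK hbal heven

end Summit.HodgeConjecture.Ring2WeilCoverage.CyclotomicSignaturesLevel32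

end
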